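import Literature.NumberTheory.LFunctions.GaussianThetaSeries
import HarnessLib

/-!
# Weight-one theta series of the binary forms `y₁² + N y₂²` with periodic coefficients:
# the `L`-series is entire

Topic `Literature/NumberTheory/LFunctions`; namespace `Literature.NumberTheory.LFunctions.BinaryTheta`.
Companion of `GaussianThetaSeries.lean` (the case `N = 1`, `ℤ[i]`), written for the theory of
complex multiplication: the Hecke `L`-series `L(ψ̄, s) = ∑ ψ̄(𝔞) N𝔞^{-s}` of the Grössencharacter
of a CM elliptic curve over `ℚ` (Deuring; Silverman, *Advanced Topics*, II.10.5), and the
*partial* series `∑_{α ≡ α₀ (𝔣)} ᾱ |α|^{-2s}` whose values at `s = 1` are the Eisenstein numbers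
`E₁*(α₀, 𝔣)` entering the elliptic-unit formula for `L(ψ̄, 1)/Ω` (Coates–Wiles 1977 §§4–6;
Rubin, LNM 1716 (1999), §7.4), are all of the following shape. Every imaginary quadratic order
contains with finite index the lattice `ℤ ⊕ ℤ√-N` on which the norm form is *diagonal*,
`N(y₁ + y₂ √-N) = y₁² + N y₂²`, and a congruence condition on `ℤ ⊕ ℤ√-N` (e.g. the parity
condition `y₁ ≡ y₂ (2)` cutting out `2𝓞_K ⊂ ℤ ⊕ ℤ√-q` for `𝓞_K = ℤ[(1+√-q)/2]`) is a periodic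
coefficient. Everything in this file is proved (Mathlib and `GaussianThetaSeries` only).

## Main result

Fix `N ≥ 1`, a period `M ≥ 1`, complex weights `u, v` and a coefficient `Ψ : ℤ × ℤ → ℂ`
periodic modulo `M` in both variables. Put `Q(y) = y₁² + N y₂²`, `w(y) = u y₁ + v y₂` and
`c(m) = ∑_{Q(y) = m} Ψ(y) w(y)` (`BinaryTheta.coeff`). Then the Dirichlet series
`∑_{m ≥ 1} c(m) m^{-s} = ∑_{y ≠ 0} Ψ(y) w(y) Q(y)^{-s}`, absolutely convergent for `Re s > 3/2`,
is the restriction of an entire function: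

* `BinaryTheta.exists_differentiable_eq_LSeries_coeff` —
  `∃ G, Differentiable ℂ G ∧ ∀ s, 3/2 < re s → G s = LSeries (coeff N Ψ u v) s`;
* explicitly `G = BinaryTheta.thetaLFunction N M Ψ u v`,
  `G(s) = (π/M)^s Γ(s)⁻¹ ∫₀^∞ θ(t) t^{s-1} dt` (`differentiable_thetaLFunction`,
  `thetaLFunction_eq_LSeries`, `hasSum_thetaLFunction`, `LSeriesHasSum_coeff`,
  `LSeriesSummable_coeff`).

## The proof (Hecke 1920, §9; as in Koblitz, Ch. II §5, and `GaussianThetaSeries`)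

`θ(t) = ∑_y Ψ(y) w(y) e^{-π t Q(y)/M}`. On the class `y ≡ c (M)`, `y = (c₁ + M z₁, c₂ + M z₂)`,
one has `Q(y)/M = M (z₁ + a)² + N M (z₂ + b)²` with `a = c₁/M`, `b = c₂/M`, so the class sum
factors into Mathlib's one-dimensional kernels *at two different scalings*:
`Θ_c(t) = M (u · oddKernel(a)(Mt) · evenKernel(b)(NMt) + v · evenKernel(a)(Mt) · oddKernel(b)(NMt))`
(`classTheta`, `hasSum_classTheta`), and `θ = ∑_c Ψ(c) Θ_c` (`theta`, `hasSum_theta`), which is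
taken as the definition. Decay `O(t^{-A})` at `∞` (`oddKernel` is exponentially small,
`evenKernel` bounded) and `O(t^{-b})` at `0⁺` (theta inversion `oddKernel(a)(x) = x^{-3/2}
sinKernel(a)(1/x)`, `evenKernel(a)(x) = x^{-1/2} cosKernel(a)(1/x)`, i.e. Poisson summation, with
`sinKernel` exponentially small and `cosKernel` bounded at `∞`) make the Mellin transform entire
(`mellin_differentiableAt_of_isBigO_rpow`); termwise integration (`hasSum_mellin_pi_mul₀`, absolute
convergence from `∑_{y ≠ 0} Q(y)^{-r} ≤ ∑ (y₁² + y₂²)^{-r} < ∞`, `r > 1`, transported from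
`GaussianTheta.summable_norm_rpow_neg`) identifies it with `π^{-s} Γ(s) ∑ Ψ(y) w(y) (Q(y)/M)^{-s}`
for `Re s > 3/2`, and regrouping by the values of `Q` gives the `L`-series of `c`.

## References

* E. Hecke, *Eine neue Art von Zetafunktionen und ihre Beziehungen zur Verteilung der
  Primzahlen. II*, Math. Z. 6 (1920) 11–51, §9 (theta series with Grössencharakteren of an
  imaginary quadratic field). [Hecke1920]
* N. Koblitz, *Introduction to Elliptic Curves and Modular Forms*, GTM 97, 2nd ed. (1993),
  Ch. II §5, Theorem and its proof (the theta-function argument for `L(E_n, s)`). [KoblitzECMF1993]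
* K. Rubin, *Elliptic curves with complex multiplication and the conjecture of Birch and
  Swinnerton-Dyer*, LNM 1716 (1999), §7.4 (Eisenstein numbers and `L(ψ̄, k)`). [Rubin1999]
-/

noncomputable section

open Complex Real Set Filter Topology Asymptotics MeasureTheory HurwitzZeta

namespace Literature.NumberTheory.LFunctions

namespace BinaryTheta

variable (N : ℕ) [NeZero N] (M : ℕ) [NeZero M]

/-! ### The form `Q(y) = y₁² + N y₂²`, the weight `w(y) = u y₁ + v y₂`, classes modulo `M` -/

/-- The positive definite binary form `Q_N(y) = y₁² + N y₂²` on `ℤ × ℤ` (the norm form of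
`ℤ ⊕ ℤ√-N`). [folklore] -/
def qf (y : ℤ × ℤ) : ℤ := y.1 ^ 2 + N * y.2 ^ 2

omit [NeZero N] in
/-- `Q_N(y) ≥ 0`. [folklore] -/
lemma qf_nonneg (y : ℤ × ℤ) : 0 ≤ qf N y := by
  unfold qf; positivity

omit [NeZero N] in
/-- `y₁² ≤ Q_N(y)`. [folklore] -/
lemma sq_fst_le_qf (y : ℤ × ℤ) : y.1 ^ 2 ≤ qf N y := by
  unfold qf; nlinarith [sq_nonneg y.2]

/-- `y₂² ≤ Q_N(y)` (`N ≥ 1`). [folklore] -/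
lemma sq_snd_le_qf (y : ℤ × ℤ) : y.2 ^ 2 ≤ qf N y := by
  have hN : (1 : ℤ) ≤ N := by exact_mod_cast Nat.one_le_iff_ne_zero.mpr (NeZero.ne N)
  unfold qf; nlinarith [sq_nonneg y.1, sq_nonneg y.2]

/-- `Q_N(y) = 0 ↔ y = 0` (`N ≥ 1`). [folklore] -/
lemma qf_eq_zero_iff (y : ℤ × ℤ) : qf N y = 0 ↔ y = 0 := by
  constructor
  · intro h
    have h1 := sq_fst_le_qf N y
    have h2 := sq_snd_le_qf N y
    rw [h] at h1 h2
    have e1 : y.1 = 0 := by nlinarith [sq_nonneg y.1]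
    have e2 : y.2 = 0 := by nlinarith [sq_nonneg y.2]
    exact Prod.ext e1 e2
  · rintro rfl
    simp [qf]

omit [NeZero N] in
/-- `Q_N(y)` as a real number. [folklore] -/
lemma qf_real (y : ℤ × ℤ) : ((qf N y : ℤ) : ℝ) = (y.1 : ℝ) ^ 2 + N * (y.2 : ℝ) ^ 2 := by
  simp only [qf]; push_cast; ring

variable (u v : ℂ)

/-- The linear weight `w(y) = u y₁ + v y₂` (for `ℤ ⊕ ℤ√-N ∋ y₁ + y₂√-N` the weights `x`, `x̄` are
`u = 1`, `v = ±√-N`). [folklore] -/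
def wt (y : ℤ × ℤ) : ℂ := u * (y.1 : ℂ) + v * (y.2 : ℂ)

omit [NeZero N] in
/-- `|y₁| ≤ Q_N(y)^{1/2}` in `ℝ`. [folklore] -/
lemma abs_fst_le_sqrt_qf (y : ℤ × ℤ) : |(y.1 : ℝ)| ≤ (((qf N y : ℤ) : ℝ)) ^ (1 / 2 : ℝ) := by
  rw [← Real.sqrt_eq_rpow, ← Real.sqrt_sq_eq_abs]
  exact Real.sqrt_le_sqrt (by exact_mod_cast sq_fst_le_qf N y)

/-- `|y₂| ≤ Q_N(y)^{1/2}` in `ℝ`. [folklore] -/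
lemma abs_snd_le_sqrt_qf (y : ℤ × ℤ) : |(y.2 : ℝ)| ≤ (((qf N y : ℤ) : ℝ)) ^ (1 / 2 : ℝ) := by
  rw [← Real.sqrt_eq_rpow, ← Real.sqrt_sq_eq_abs]
  exact Real.sqrt_le_sqrt (by exact_mod_cast sq_snd_le_qf N y)

/-- `‖w(y)‖ ≤ (‖u‖ + ‖v‖) Q_N(y)^{1/2}`. [folklore] -/
lemma norm_wt_le (y : ℤ × ℤ) : ‖wt u v y‖ ≤ (‖u‖ + ‖v‖) * (((qf N y : ℤ) : ℝ)) ^ (1 / 2 : ℝ) := by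
  have h1 := abs_fst_le_sqrt_qf N y
  have h2 := abs_snd_le_sqrt_qf N y
  calc ‖wt u v y‖ ≤ ‖u * (y.1 : ℂ)‖ + ‖v * (y.2 : ℂ)‖ := norm_add_le _ _
    _ = ‖u‖ * |(y.1 : ℝ)| + ‖v‖ * |(y.2 : ℝ)| := by
        rw [norm_mul, norm_mul, ← Complex.ofReal_intCast, ← Complex.ofReal_intCast, norm_real,
          norm_real, Real.norm_eq_abs, Real.norm_eq_abs]
    _ ≤ ‖u‖ * (((qf N y : ℤ) : ℝ)) ^ (1 / 2 : ℝ) + ‖v‖ * (((qf N y : ℤ) : ℝ)) ^ (1 / 2 : ℝ) := by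
        gcongr
    _ = (‖u‖ + ‖v‖) * (((qf N y : ℤ) : ℝ)) ^ (1 / 2 : ℝ) := by ring

/-- The class of `y` modulo `M` in both variables. [folklore] -/
def cls (y : ℤ × ℤ) : ZMod M × ZMod M := ((y.1 : ZMod M), (y.2 : ZMod M))

/-- Parametrisation of the class `c` by `ℤ × ℤ`: `z ↦ (c₁ + M z₁, c₂ + M z₂)` with `0 ≤ cᵢ < M` the
canonical representatives. [folklore] -/
def rep (c : ZMod M × ZMod M) (z : ℤ × ℤ) : ℤ × ℤ :=
  ((c.1.val : ℤ) + M * z.1, (c.2.val : ℤ) + M * z.2)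

omit [NeZero M] in
/-- First coordinate of `rep M c z`. [folklore] -/
@[simp] lemma rep_fst (c : ZMod M × ZMod M) (z : ℤ × ℤ) : (rep M c z).1 = (c.1.val : ℤ) + M * z.1 :=
  rfl

omit [NeZero M] in
/-- Second coordinate of `rep M c z`. [folklore] -/
@[simp] lemma rep_snd (c : ZMod M × ZMod M) (z : ℤ × ℤ) : (rep M c z).2 = (c.2.val : ℤ) + M * z.2 :=
  rfl

/-- The parametrisation of a class is injective (`M ≠ 0`). [folklore] -/
lemma rep_injective (c : ZMod M × ZMod M) : Function.Injective (rep M c) := by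
  intro z z' h
  have hM : (M : ℤ) ≠ 0 := by exact_mod_cast (NeZero.ne M)
  have h1 := congrArg Prod.fst h
  have h2 := congrArg Prod.snd h
  simp only [rep_fst, rep_snd, add_right_inj] at h1 h2
  exact Prod.ext (mul_left_cancel₀ hM h1) (mul_left_cancel₀ hM h2)

/-- `rep M c z` lies in the class `c`. [folklore] -/
lemma cls_rep (c : ZMod M × ZMod M) (z : ℤ × ℤ) : cls M (rep M c z) = c := by
  ext <;> simp [cls, rep]

/-- Every element of the class `c` is some `rep M c z`. [folklore] -/
lemma exists_rep_eq {y : ℤ × ℤ} {c : ZMod M × ZMod M} (h : cls M y = c) : ∃ z, rep M c z = y := by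
  have h1 : (y.1 : ZMod M) = ((c.1.val : ℤ) : ZMod M) := by
    rw [Int.cast_natCast, ZMod.natCast_zmod_val]; exact congrArg Prod.fst h
  have h2 : (y.2 : ZMod M) = ((c.2.val : ℤ) : ZMod M) := by
    rw [Int.cast_natCast, ZMod.natCast_zmod_val]; exact congrArg Prod.snd h
  rw [ZMod.intCast_eq_intCast_iff_dvd_sub] at h1 h2
  obtain ⟨k₁, hk₁⟩ := h1
  obtain ⟨k₂, hk₂⟩ := h2
  refine ⟨(-k₁, -k₂), Prod.ext ?_ ?_⟩
  · simp only [rep_fst]; linarith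
  · simp only [rep_snd]; linarith

/-- `rep M c z = rep M c 0 + M z`. [folklore] -/
lemma rep_eq_rep_zero_add (c : ZMod M × ZMod M) (z : ℤ × ℤ) :
    rep M c z = ((rep M c 0).1 + M * z.1, (rep M c 0).2 + M * z.2) := by
  refine Prod.ext ?_ ?_ <;> simp [rep]

/-- The class `c` is exactly the range of `rep M c`. [folklore] -/
lemma range_rep (c : ZMod M × ZMod M) : Set.range (rep M c) = {y | cls M y = c} := by
  ext y
  constructor
  · rintro ⟨z, rfl⟩
    exact cls_rep M c z
  · exact fun h ↦ exists_rep_eq M h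

/-! ### The theta function of a class and of a periodic coefficient -/

/-- The weight-one theta series of the class `c` modulo `M`, as a function of `t > 0`:
`Θ_c(t) = ∑_{y ≡ c (M)} w(y) e^{-π t Q_N(y)/M}`, written through Mathlib's one-dimensional
kernels at the two scalings `M t` and `N M t` (see `hasSum_classTheta`; Hecke 1920 §9).
[folklore] -/
def classTheta (c : ZMod M × ZMod M) (t : ℝ) : ℂ :=
  (M : ℂ) * (u * ((oddKernel (((c.1.val : ℝ) / M : ℝ) : UnitAddCircle) (M * t) : ℂ) *
      (evenKernel (((c.2.val : ℝ) / M : ℝ) : UnitAddCircle) (N * (M * t)) : ℂ)) +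
    v * ((evenKernel (((c.1.val : ℝ) / M : ℝ) : UnitAddCircle) (M * t) : ℂ) *
      (oddKernel (((c.2.val : ℝ) / M : ℝ) : UnitAddCircle) (N * (M * t)) : ℂ)))

variable (Ψ : ℤ × ℤ → ℂ)

/-- The weight-one theta function of a coefficient `Ψ : ℤ × ℤ → ℂ` periodic modulo `M`:
`θ(t) = ∑_y Ψ(y) w(y) e^{-π t Q_N(y)/M}` (`hasSum_theta`), defined as the finite combination
`∑_c Ψ(c) Θ_c(t)` of class theta series. [folklore] -/
def theta (t : ℝ) : ℂ := ∑ c : ZMod M × ZMod M, Ψ (rep M c 0) * classTheta N M u v c t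

/-- The summand `Ψ(y) w(y) e^{-π t Q_N(y)/M}` of the defining series of `θ`. [folklore] -/
def thetaTerm (t : ℝ) (y : ℤ × ℤ) : ℂ :=
  Ψ y * wt u v y * (rexp (-π * t * ((qf N y : ℤ) : ℝ) / M) : ℂ)

/-- **`Θ_c(t) = ∑_{y ≡ c (M)} w(y) e^{-π t Q_N(y)/M}`** for `t > 0`: the class sum factors into
products of Mathlib's `oddKernel`/`evenKernel` series at the scalings `M t`, `N M t`
(Hecke 1920 §9). [folklore] -/
lemma hasSum_classTheta (c : ZMod M × ZMod M) {t : ℝ} (ht : 0 < t) :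
    HasSum (fun z : ℤ × ℤ ↦ wt u v (rep M c z) *
      (rexp (-π * t * ((qf N (rep M c z) : ℤ) : ℝ) / M) : ℂ)) (classTheta N M u v c t) := by
  have hM : (0 : ℝ) < M := by exact_mod_cast Nat.pos_of_ne_zero (NeZero.ne M)
  have hN : (0 : ℝ) < N := by exact_mod_cast Nat.pos_of_ne_zero (NeZero.ne N)
  have hx : 0 < (M : ℝ) * t := mul_pos hM ht
  have hx' : 0 < (N : ℝ) * ((M : ℝ) * t) := mul_pos hN hx
  unfold classTheta
  set a : ℝ := (c.1.val : ℝ) / M with ha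
  set b : ℝ := (c.2.val : ℝ) / M with hb
  -- the one-dimensional series and their absolute convergence
  let fO : ℝ → ℝ → ℤ → ℂ := fun x a' m ↦ (((m + a') * rexp (-π * (m + a') ^ 2 * x) : ℝ) : ℂ)
  let fE : ℝ → ℝ → ℤ → ℂ := fun x a' m ↦ ((rexp (-π * (m + a') ^ 2 * x) : ℝ) : ℂ)
  have hO {x : ℝ} (hx0 : 0 < x) (a' : ℝ) :
      HasSum (fO x a') (oddKernel (a' : UnitAddCircle) x : ℂ) :=
    Complex.hasSum_ofReal.mpr (hasSum_int_oddKernel a' hx0)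
  have hE {x : ℝ} (hx0 : 0 < x) (a' : ℝ) :
      HasSum (fE x a') (evenKernel (a' : UnitAddCircle) x : ℂ) :=
    Complex.hasSum_ofReal.mpr (hasSum_int_evenKernel a' hx0)
  have hnO {x : ℝ} (hx0 : 0 < x) (a' : ℝ) : Summable fun m : ℤ ↦ ‖fO x a' m‖ := by
    refine (HurwitzKernelBounds.summable_f_int 1 a' hx0).congr fun m ↦ ?_
    simp only [fO]
    rw [norm_real, Real.norm_eq_abs, abs_mul, abs_of_pos (Real.exp_pos _),
      HurwitzKernelBounds.f_int, pow_one]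
  have hnE {x : ℝ} (hx0 : 0 < x) (a' : ℝ) : Summable fun m : ℤ ↦ ‖fE x a' m‖ := by
    refine (HurwitzKernelBounds.summable_f_int 0 a' hx0).congr fun m ↦ ?_
    simp only [fE]
    rw [norm_real, Real.norm_eq_abs, abs_of_pos (Real.exp_pos _),
      HurwitzKernelBounds.f_int, pow_zero, one_mul]
  have hP₁ : HasSum (fun z : ℤ × ℤ ↦ fO (M * t) a z.1 * fE (N * (M * t)) b z.2)
      ((oddKernel (a : UnitAddCircle) (M * t) : ℂ) *
        (evenKernel (b : UnitAddCircle) (N * (M * t)) : ℂ)) :=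
    (hO hx a).mul (hE hx' b) (summable_mul_of_summable_norm (hnO hx a) (hnE hx' b))
  have hP₂ : HasSum (fun z : ℤ × ℤ ↦ fE (M * t) a z.1 * fO (N * (M * t)) b z.2)
      ((evenKernel (a : UnitAddCircle) (M * t) : ℂ) *
        (oddKernel (b : UnitAddCircle) (N * (M * t)) : ℂ)) :=
    (hE hx a).mul (hO hx' b) (summable_mul_of_summable_norm (hnE hx a) (hnO hx' b))
  have hS := ((hP₁.mul_left u).add (hP₂.mul_left v)).mul_left (M : ℂ)
  refine hS.congr_fun fun z ↦ ?_
  simp only [fO, fE]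
  have hMne : (M : ℝ) ≠ 0 := hM.ne'
  have h1 : (c.1.val : ℝ) + M * z.1 = M * (z.1 + a) := by rw [ha]; field_simp; ring
  have h2 : (c.2.val : ℝ) + M * z.2 = M * (z.2 + b) := by rw [hb]; field_simp; ring
  have hexp : rexp (-π * t * (((qf N (rep M c z) : ℤ) : ℝ)) / M) =
      rexp (-π * (z.1 + a) ^ 2 * (M * t)) * rexp (-π * (z.2 + b) ^ 2 * (N * (M * t))) := by
    rw [← Real.exp_add, qf_real, rep_fst, rep_snd]
    push_cast
    rw [h1, h2]
    congr 1
    field_simp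
    ring
  have hX₁ : (((rep M c z).1 : ℤ) : ℂ) = (M : ℂ) * ((z.1 + a : ℝ) : ℂ) := by
    have : (((rep M c z).1 : ℤ) : ℂ) = (((c.1.val : ℝ) + M * z.1 : ℝ) : ℂ) := by
      rw [rep_fst]; push_cast; ring
    rw [this, h1]
    push_cast
    ring
  have hX₂ : (((rep M c z).2 : ℤ) : ℂ) = (M : ℂ) * ((z.2 + b : ℝ) : ℂ) := by
    have : (((rep M c z).2 : ℤ) : ℂ) = (((c.2.val : ℝ) + M * z.2 : ℝ) : ℂ) := by
      rw [rep_snd]; push_cast; ring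
    rw [this, h2]
    push_cast
    ring
  rw [hexp, wt, hX₁, hX₂]
  push_cast
  ring

/-- **`θ` is the series `∑_y Ψ(y) w(y) e^{-π t Q_N(y)/M}`** for `Ψ` periodic modulo `M` and
`t > 0` (grouping the absolutely convergent double series by classes modulo `M`; Hecke 1920 §9;
Koblitz, Ch. II §5). [folklore] -/
theorem hasSum_theta (hΨ : ∀ y z : ℤ × ℤ, Ψ (y.1 + M * z.1, y.2 + M * z.2) = Ψ y) {t : ℝ}
    (ht : 0 < t) : HasSum (thetaTerm N M u v Ψ t) (theta N M u v Ψ t) := by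
  classical
  have key : ∀ c : ZMod M × ZMod M,
      HasSum (fun y ↦ if cls M y = c then thetaTerm N M u v Ψ t y else 0)
        (Ψ (rep M c 0) * classTheta N M u v c t) := by
    intro c
    have hoff : ∀ y ∉ Set.range (rep M c),
        (fun y ↦ if cls M y = c then thetaTerm N M u v Ψ t y else 0) y = 0 := by
      intro y hy
      rw [range_rep] at hy
      exact if_neg hy
    refine ((rep_injective M c).hasSum_iff hoff).mp ?_
    have heq : ((fun y ↦ if cls M y = c then thetaTerm N M u v Ψ t y else 0) ∘ rep M c) =
        fun z ↦ Ψ (rep M c 0) * (wt u v (rep M c z) *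
          (rexp (-π * t * ((qf N (rep M c z) : ℤ) : ℝ) / M) : ℂ)) := by
      funext z
      simp only [Function.comp_apply, cls_rep, if_true, thetaTerm]
      have hper : Ψ (rep M c z) = Ψ (rep M c 0) := by
        rw [rep_eq_rep_zero_add M c z, hΨ]
      rw [hper]
      ring
    rw [heq]
    exact (hasSum_classTheta N M u v c ht).mul_left _
  have := hasSum_sum (s := (Finset.univ : Finset (ZMod M × ZMod M))) fun c _ ↦ key c
  refine this.congr_fun fun y ↦ ?_
  simp only [Finset.sum_ite_eq, Finset.mem_univ, if_true]

/-- A coefficient periodic modulo `M` is bounded (it takes finitely many values). [folklore] -/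
theorem norm_le_of_periodic (hΨ : ∀ y z : ℤ × ℤ, Ψ (y.1 + M * z.1, y.2 + M * z.2) = Ψ y)
    (y : ℤ × ℤ) : ‖Ψ y‖ ≤ ∑ c : ZMod M × ZMod M, ‖Ψ (rep M c 0)‖ := by
  obtain ⟨z, hz⟩ := exists_rep_eq M (c := cls M y) rfl
  rw [← hz, rep_eq_rep_zero_add, hΨ]
  exact Finset.single_le_sum (f := fun c ↦ ‖Ψ (rep M c 0)‖) (fun _ _ ↦ norm_nonneg _)
    (Finset.mem_univ (cls M y))

/-! ### Convergence of `∑ Q_N(y)^{-r}` for `r > 1` -/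

/-- `∑_{y ≠ 0} Q_N(y)^{-r}` converges for `r > 1`: `Q_N(y) ≥ y₁² + y₂² = N_{ℚ(i)/ℚ}(y₁ + y₂ i)` and
`GaussianTheta.summable_norm_rpow_neg`. The term at `y = 0` is the junk value `0 ^ (-r) = 0`.
[folklore] -/
theorem summable_qf_rpow_neg {r : ℝ} (hr : 1 < r) :
    Summable fun y : ℤ × ℤ ↦ (((qf N y : ℤ) : ℝ)) ^ (-r) := by
  let e : ℤ × ℤ ≃ GaussianInt :=
    { toFun := fun p ↦ ⟨p.1, p.2⟩
      invFun := fun x ↦ (x.re, x.im)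
      left_inv := fun p ↦ rfl
      right_inv := fun x ↦ rfl }
  have hG : Summable fun y : ℤ × ℤ ↦ ((((e y).norm : ℤ) : ℝ)) ^ (-r) :=
    (e.summable_iff (f := fun x : GaussianInt ↦ (((x.norm : ℤ) : ℝ)) ^ (-r))).mpr
      (GaussianTheta.summable_norm_rpow_neg hr)
  refine Summable.of_nonneg_of_le (fun y ↦ Real.rpow_nonneg (by exact_mod_cast qf_nonneg N y) _)
    (fun y ↦ ?_) hG
  have hn : ((((e y).norm : ℤ) : ℝ)) = (y.1 : ℝ) ^ 2 + (y.2 : ℝ) ^ 2 := by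
    simp only [e, Equiv.coe_fn_mk, Zsqrtd.norm_def]; push_cast; ring
  rw [hn, qf_real]
  have hN0 : (0 : ℝ) ≤ N := Nat.cast_nonneg N
  rcases eq_or_ne y 0 with rfl | hy
  · simp only [Prod.fst_zero, Prod.snd_zero, Int.cast_zero]
    rw [show (0 : ℝ) ^ 2 + N * 0 ^ 2 = 0 by ring, show (0 : ℝ) ^ 2 + 0 ^ 2 = 0 by ring]
  · have hpos : 0 < (y.1 : ℝ) ^ 2 + (y.2 : ℝ) ^ 2 := by
      rcases eq_or_ne y.1 0 with h1 | h1
      · have h2 : y.2 ≠ 0 := fun h2 ↦ hy (Prod.ext h1 h2)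
        have : (y.2 : ℝ) ≠ 0 := by exact_mod_cast h2
        positivity
      · have : (y.1 : ℝ) ≠ 0 := by exact_mod_cast h1
        positivity
    have hN1 : (1 : ℝ) ≤ N := by exact_mod_cast Nat.one_le_iff_ne_zero.mpr (NeZero.ne N)
    refine Real.rpow_le_rpow_of_nonpos hpos ?_ (by linarith)
    nlinarith [sq_nonneg (y.2 : ℝ)]

/-! ### The Dirichlet series: absolute convergence for `Re s > 3/2` and the Mellin identity -/

/-- Absolute convergence of `∑ Ψ(y) w(y) (Q_N(y)/M)^{-σ}` for `σ > 3/2` and periodic `Ψ`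
(comparison with `∑ Q_N(y)^{-(σ - 1/2)}`). [folklore] -/
theorem summable_norm_div_rpow (hΨ : ∀ y z : ℤ × ℤ, Ψ (y.1 + M * z.1, y.2 + M * z.2) = Ψ y)
    {σ : ℝ} (hσ : 3 / 2 < σ) :
    Summable fun y : ℤ × ℤ ↦ ‖Ψ y * wt u v y‖ / ((((qf N y : ℤ) : ℝ)) / M) ^ σ := by
  have hM : (0 : ℝ) < M := by exact_mod_cast Nat.pos_of_ne_zero (NeZero.ne M)
  set B : ℝ := ∑ c : ZMod M × ZMod M, ‖Ψ (rep M c 0)‖ with hB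
  have hB0 : 0 ≤ B := Finset.sum_nonneg fun _ _ ↦ norm_nonneg _
  have hdom := (summable_qf_rpow_neg N (r := σ - 1 / 2) (by linarith)).mul_left
    (B * (‖u‖ + ‖v‖) * (M : ℝ) ^ σ)
  refine Summable.of_nonneg_of_le (fun y ↦ ?_) (fun y ↦ ?_) hdom
  · exact div_nonneg (norm_nonneg _) (Real.rpow_nonneg
      (div_nonneg (by exact_mod_cast qf_nonneg N y) hM.le) _)
  · have hQ0 : (0 : ℝ) ≤ ((qf N y : ℤ) : ℝ) := by exact_mod_cast qf_nonneg N y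
    rcases hQ0.eq_or_lt with hQ | hQ
    · -- `y = 0`
      have hy : y = 0 := by
        rw [← qf_eq_zero_iff N]; exact_mod_cast hQ.symm
      subst hy
      simp only [wt, Prod.fst_zero, Prod.snd_zero, Int.cast_zero, mul_zero, add_zero, norm_zero,
        zero_div]
      exact mul_nonneg (mul_nonneg (mul_nonneg hB0 (by positivity)) (Real.rpow_nonneg hM.le _))
        (Real.rpow_nonneg hQ0 _)
    · rw [norm_mul, Real.div_rpow hQ0 hM.le, div_div_eq_mul_div]
      rw [div_le_iff₀ (Real.rpow_pos_of_pos hQ _)]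
      calc ‖Ψ y‖ * ‖wt u v y‖ * (M : ℝ) ^ σ
          ≤ B * ((‖u‖ + ‖v‖) * (((qf N y : ℤ) : ℝ)) ^ (1 / 2 : ℝ)) * (M : ℝ) ^ σ := by
            gcongr
            · exact norm_le_of_periodic M Ψ hΨ y
            · exact norm_wt_le N u v y
        _ = B * (‖u‖ + ‖v‖) * (M : ℝ) ^ σ * (((qf N y : ℤ) : ℝ)) ^ (-(σ - 1 / 2)) *
              (((qf N y : ℤ) : ℝ)) ^ σ := by
            rw [mul_assoc (B * (‖u‖ + ‖v‖) * (M : ℝ) ^ σ), ← Real.rpow_add hQ]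
            ring_nf

/-- `w(0) = 0`. [folklore] -/
@[simp] lemma wt_zero : wt u v 0 = 0 := by simp [wt]

/-- **Mellin transform of `θ`**: for `Re s > 3/2`,
`∫₀^∞ θ(t) t^{s-1} dt = π^{-s} Γ(s) ∑_y Ψ(y) w(y) (Q_N(y)/M)^{-s}` (termwise integration of the
absolutely convergent theta series; Hecke 1920 §9, Koblitz Ch. II §5). [folklore] -/
theorem hasSum_mellin_theta (hΨ : ∀ y z : ℤ × ℤ, Ψ (y.1 + M * z.1, y.2 + M * z.2) = Ψ y) {s : ℂ}
    (hs : 3 / 2 < s.re) :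
    HasSum (fun y : ℤ × ℤ ↦ (π : ℂ) ^ (-s) * Complex.Gamma s * (Ψ y * wt u v y) /
      (((((qf N y : ℤ) : ℝ)) / M : ℝ) : ℂ) ^ s) (mellin (theta N M u v Ψ) s) := by
  have hM : (0 : ℝ) < M := by exact_mod_cast Nat.pos_of_ne_zero (NeZero.ne M)
  refine hasSum_mellin_pi_mul₀ (fun y ↦ div_nonneg (by exact_mod_cast qf_nonneg N y) hM.le)
    (by linarith) (fun t ht ↦ ?_) (summable_norm_div_rpow N M u v Ψ hΨ hs)
  refine (hasSum_theta N M u v Ψ hΨ ht).congr_fun fun y ↦ ?_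
  split_ifs with h
  · have hy : y = 0 := by
      rw [div_eq_zero_iff, or_iff_left hM.ne'] at h
      rw [← qf_eq_zero_iff N]; exact_mod_cast h
    simp [thetaTerm, hy]
  · simp only [thetaTerm]
    congr 2
    ring_nf

/-! ### Regrouping by the values of `Q_N`: the `L`-series `∑ c(m) m^{-s}` -/

/-- The (finite) set of `y ∈ ℤ × ℤ` with `Q_N(y) = m`. [folklore] -/
def qfEq (m : ℕ) : Finset (ℤ × ℤ) :=
  ((Finset.Icc (-(m : ℤ)) m) ×ˢ (Finset.Icc (-(m : ℤ)) m)).filter fun y ↦ qf N y = m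

/-- `y ∈ qfEq N m ↔ Q_N(y) = m` (`|y₁|, |y₂| ≤ Q_N(y)`). [folklore] -/
lemma mem_qfEq {m : ℕ} {y : ℤ × ℤ} : y ∈ qfEq N m ↔ qf N y = m := by
  simp only [qfEq, Finset.mem_filter, Finset.mem_product, Finset.mem_Icc, and_iff_right_iff_imp]
  intro h
  have h1 := sq_fst_le_qf N y
  have h2 := sq_snd_le_qf N y
  rw [h] at h1 h2
  have e1 : (y.1.natAbs : ℤ) ≤ m := by nlinarith [Int.natAbs_le_self_sq y.1]
  have e2 : (y.2.natAbs : ℤ) ≤ m := by nlinarith [Int.natAbs_le_self_sq y.2]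
  refine ⟨⟨?_, ?_⟩, ?_, ?_⟩ <;> omega

/-- Only `0` has `Q_N = 0`. [folklore] -/
lemma qfEq_zero : qfEq N 0 = {0} := by
  ext y
  rw [mem_qfEq, Finset.mem_singleton, Nat.cast_zero, qf_eq_zero_iff]

/-- The coefficients of the `L`-series of `θ`: `c(m) = ∑_{Q_N(y) = m} Ψ(y) w(y)`. [folklore] -/
def coeff (m : ℕ) : ℂ := ∑ y ∈ qfEq N m, Ψ y * wt u v y

/-- `c(0) = 0`. [folklore] -/
@[simp] lemma coeff_zero : coeff N u v Ψ 0 = 0 := by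
  simp [coeff, qfEq_zero]

/-- Regrouping an absolutely convergent series over `ℤ × ℤ` by the values of `Q_N` gives an
`L`-series: `∑_y Ψ(y) w(y) Q_N(y)^{-s} = ∑_m c(m) m^{-s}`. [folklore] -/
theorem LSeriesHasSum_coeff_of_hasSum {s A : ℂ}
    (h : HasSum (fun y : ℤ × ℤ ↦ Ψ y * wt u v y / (((qf N y : ℤ) : ℂ)) ^ s) A) :
    LSeriesHasSum (coeff N u v Ψ) s A := by
  have h2 := h.tsum_fiberwise fun y : ℤ × ℤ ↦ (qf N y).natAbs
  refine h2.congr_fun fun m ↦ ?_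
  have hset : ((fun y : ℤ × ℤ ↦ (qf N y).natAbs) ⁻¹' {m}) = ↑(qfEq N m) := by
    ext y
    simp only [Set.mem_preimage, Set.mem_singleton_iff, Finset.mem_coe, mem_qfEq]
    have := qf_nonneg N y
    omega
  rw [tsum_congr_set_coe (fun y : ℤ × ℤ ↦ Ψ y * wt u v y / (((qf N y : ℤ) : ℂ)) ^ s) hset,
    Finset.tsum_subtype' (qfEq N m) (fun y : ℤ × ℤ ↦ Ψ y * wt u v y / (((qf N y : ℤ) : ℂ)) ^ s)]
  rw [LSeries.term]
  split_ifs with hm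
  · subst hm
    simp [qfEq_zero]
  · rw [coeff, Finset.sum_div]
    refine Finset.sum_congr rfl fun y hy ↦ ?_
    rw [mem_qfEq] at hy
    rw [hy]
    norm_cast

/-! ### Decay of `θ` at `∞` and at `0`; the Mellin transform is entire -/

omit [NeZero M] in
/-- `1/(L t) → ∞` as `t → 0⁺` (`L > 0`). [folklore] -/
lemma tendsto_one_div_mul_nhdsGT {L : ℝ} (hL : 0 < L) :
    Tendsto (fun t : ℝ ↦ 1 / (L * t)) (𝓝[>] 0) atTop := by
  have : Tendsto (fun t : ℝ ↦ t⁻¹ * L⁻¹) (𝓝[>] 0) atTop :=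
    tendsto_inv_nhdsGT_zero.atTop_mul_const (inv_pos.mpr hL)
  refine this.congr fun t ↦ ?_
  rw [one_div, mul_inv, mul_comm]

omit [NeZero M] in
/-- `sinKernel a (1/(L t)) = O(t^e)` as `t → 0⁺`, for every `e` (exponential decay of `sinKernel`
at `∞`). [folklore] -/
lemma isBigO_nhdsGT_sinKernel_comp (a : UnitAddCircle) {L : ℝ} (hL : 0 < L) (e : ℝ) :
    (fun t : ℝ ↦ (sinKernel a (1 / (L * t)) : ℂ)) =O[𝓝[>] 0] fun t : ℝ ↦ t ^ e := by
  obtain ⟨p, hp, h⟩ := isBigO_atTop_sinKernel a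
  have hg : (fun u ↦ (sinKernel a u : ℂ)) =O[atTop] fun u ↦ rexp (-p * u) :=
    Complex.isBigO_ofReal_left.mpr h
  have h1 := GaussianTheta.isBigO_nhdsGT_zero_of_isBigO_atTop hp hg hL 0 (-e)
  rw [neg_neg] at h1
  refine h1.congr' ?_ EventuallyEq.rfl
  filter_upwards [self_mem_nhdsWithin] with t (ht : 0 < t)
  rw [neg_zero, Real.rpow_zero]
  push_cast
  ring

omit [NeZero M] in
/-- `cosKernel a (1/(L t)) = O(1)` as `t → 0⁺`. [folklore] -/
lemma isBigO_nhdsGT_cosKernel_comp (a : UnitAddCircle) {L : ℝ} (hL : 0 < L) :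
    (fun t : ℝ ↦ (cosKernel a (1 / (L * t)) : ℂ)) =O[𝓝[>] 0] fun _ : ℝ ↦ (1 : ℝ) :=
  (GaussianTheta.isBigO_atTop_cosKernel_one a).comp_tendsto (tendsto_one_div_mul_nhdsGT hL)

omit [NeZero M] in
/-- `1/(L t)^e = L^{-e} t^{-e} = O(t^{-e})` as `t → 0⁺`. [folklore] -/
lemma isBigO_nhdsGT_one_div_mul_rpow {L : ℝ} (hL : 0 < L) (e : ℝ) :
    (fun t : ℝ ↦ (((1 / (L * t) ^ e : ℝ)) : ℂ)) =O[𝓝[>] 0] fun t : ℝ ↦ t ^ (-e) := by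
  rw [Complex.isBigO_ofReal_left]
  refine (IsBigO.of_bound (L ^ (-e)) ?_)
  filter_upwards [self_mem_nhdsWithin] with t (ht : 0 < t)
  rw [one_div, ← Real.rpow_neg (mul_pos hL ht).le, Real.mul_rpow hL.le ht.le, Real.norm_eq_abs,
    Real.norm_eq_abs, abs_mul, abs_of_pos (Real.rpow_pos_of_pos hL _),
    abs_of_pos (Real.rpow_pos_of_pos ht _)]

omit [NeZero N] [NeZero M] in
/-- **Theta inversion for `Θ_c`**: for `t > 0`,
`Θ_c(t) = M (u (Mt)^{-3/2} (NMt)^{-1/2} sinKernel(a)(1/(Mt)) cosKernel(b)(1/(NMt))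
  + v (Mt)^{-1/2} (NMt)^{-3/2} cosKernel(a)(1/(Mt)) sinKernel(b)(1/(NMt)))`, from the functional
equations of Mathlib's `oddKernel`/`evenKernel` (Poisson summation; Hecke 1920 §9). [folklore] -/
theorem classTheta_eq_of_pos (c : ZMod M × ZMod M) (t : ℝ) :
    classTheta N M u v c t = (M : ℂ) *
      (u * ((((1 / ((M : ℝ) * t) ^ (3 / 2 : ℝ) : ℝ)) : ℂ) *
          (sinKernel (((c.1.val : ℝ) / M : ℝ) : UnitAddCircle) (1 / (M * t)) : ℂ)) *
        ((((1 / ((N : ℝ) * ((M : ℝ) * t)) ^ (1 / 2 : ℝ) : ℝ)) : ℂ) *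
          (cosKernel (((c.2.val : ℝ) / M : ℝ) : UnitAddCircle) (1 / (N * (M * t))) : ℂ)) +
      v * ((((1 / ((M : ℝ) * t) ^ (1 / 2 : ℝ) : ℝ)) : ℂ) *
          (cosKernel (((c.1.val : ℝ) / M : ℝ) : UnitAddCircle) (1 / (M * t)) : ℂ)) *
        ((((1 / ((N : ℝ) * ((M : ℝ) * t)) ^ (3 / 2 : ℝ) : ℝ)) : ℂ) *
          (sinKernel (((c.2.val : ℝ) / M : ℝ) : UnitAddCircle) (1 / (N * (M * t))) : ℂ))) := by
  unfold classTheta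
  rw [oddKernel_functional_equation (((c.1.val : ℝ) / M : ℝ) : UnitAddCircle),
    evenKernel_functional_equation (((c.1.val : ℝ) / M : ℝ) : UnitAddCircle),
    oddKernel_functional_equation (((c.2.val : ℝ) / M : ℝ) : UnitAddCircle),
    evenKernel_functional_equation (((c.2.val : ℝ) / M : ℝ) : UnitAddCircle)]
  push_cast
  ring

omit [NeZero N] [NeZero M] in
/-- `t^{-3/2} · t^e · (t^{-1/2} · 1) = t^{-b}` near `0⁺` when `e = 2 - b`. [folklore] -/
lemma rpow_combination_eventuallyEq (b : ℝ) :
    (fun t : ℝ ↦ t ^ (-(3 / 2 : ℝ)) * t ^ (2 - b) * (t ^ (-(1 / 2 : ℝ)) * (1 : ℝ))) =ᶠ[𝓝[>] 0]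
      fun t : ℝ ↦ t ^ (-b) := by
  filter_upwards [self_mem_nhdsWithin] with t (ht : 0 < t)
  rw [mul_one, ← Real.rpow_add ht, ← Real.rpow_add ht]
  ring_nf

omit [NeZero N] [NeZero M] in
/-- `t^{-1/2} · 1 · (t^{-3/2} · t^e) = t^{-b}` near `0⁺` when `e = 2 - b`. [folklore] -/
lemma rpow_combination_eventuallyEq' (b : ℝ) :
    (fun t : ℝ ↦ t ^ (-(1 / 2 : ℝ)) * (1 : ℝ) * (t ^ (-(3 / 2 : ℝ)) * t ^ (2 - b))) =ᶠ[𝓝[>] 0]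
      fun t : ℝ ↦ t ^ (-b) := by
  filter_upwards [self_mem_nhdsWithin] with t (ht : 0 < t)
  rw [mul_one, ← Real.rpow_add ht, ← Real.rpow_add ht]
  ring_nf

/-- Decay of `Θ_c` at `0⁺`: `Θ_c(t) = O(t^{-b})` for every `b` (a weight-one theta series has no
constant term on either side of the inversion). [folklore] -/
theorem isBigO_nhdsGT_classTheta (c : ZMod M × ZMod M) (b : ℝ) :
    classTheta N M u v c =O[𝓝[>] 0] fun t : ℝ ↦ t ^ (-b) := by
  have hM : (0 : ℝ) < M := by exact_mod_cast Nat.pos_of_ne_zero (NeZero.ne M)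
  have hN : (0 : ℝ) < N := by exact_mod_cast Nat.pos_of_ne_zero (NeZero.ne N)
  have hNM : (0 : ℝ) < N * M := mul_pos hN hM
  set a : UnitAddCircle := (((c.1.val : ℝ) / M : ℝ) : UnitAddCircle) with ha
  set b' : UnitAddCircle := (((c.2.val : ℝ) / M : ℝ) : UnitAddCircle) with hb'
  -- the eight factors
  have hA₁ := isBigO_nhdsGT_one_div_mul_rpow hM (3 / 2 : ℝ)
  have hA₂ := isBigO_nhdsGT_sinKernel_comp a hM (2 - b)
  have hA₃ : (fun t : ℝ ↦ (((1 / ((N : ℝ) * ((M : ℝ) * t)) ^ (1 / 2 : ℝ) : ℝ)) : ℂ)) =O[𝓝[>] 0]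
      fun t : ℝ ↦ t ^ (-(1 / 2 : ℝ)) := by
    refine (isBigO_nhdsGT_one_div_mul_rpow hNM (1 / 2 : ℝ)).congr_left fun t ↦ ?_
    rw [mul_assoc]
  have hA₄ : (fun t : ℝ ↦ (cosKernel b' (1 / (N * (M * t))) : ℂ)) =O[𝓝[>] 0]
      fun _ : ℝ ↦ (1 : ℝ) := by
    refine (isBigO_nhdsGT_cosKernel_comp b' hNM).congr_left fun t ↦ ?_
    rw [mul_assoc]
  have hB₁ := isBigO_nhdsGT_one_div_mul_rpow hM (1 / 2 : ℝ)
  have hB₂ := isBigO_nhdsGT_cosKernel_comp a hM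
  have hB₃ : (fun t : ℝ ↦ (((1 / ((N : ℝ) * ((M : ℝ) * t)) ^ (3 / 2 : ℝ) : ℝ)) : ℂ)) =O[𝓝[>] 0]
      fun t : ℝ ↦ t ^ (-(3 / 2 : ℝ)) := by
    refine (isBigO_nhdsGT_one_div_mul_rpow hNM (3 / 2 : ℝ)).congr_left fun t ↦ ?_
    rw [mul_assoc]
  have hB₄ : (fun t : ℝ ↦ (sinKernel b' (1 / (N * (M * t))) : ℂ)) =O[𝓝[>] 0]
      fun t : ℝ ↦ t ^ (2 - b) := by
    refine (isBigO_nhdsGT_sinKernel_comp b' hNM (2 - b)).congr_left fun t ↦ ?_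
    rw [mul_assoc]
  have hT₁ := (((hA₁.mul hA₂).mul (hA₃.mul hA₄)).trans
    (rpow_combination_eventuallyEq b).isBigO).const_mul_left u
  have hT₂ := (((hB₁.mul hB₂).mul (hB₃.mul hB₄)).trans
    (rpow_combination_eventuallyEq' b).isBigO).const_mul_left v
  refine ((hT₁.add hT₂).const_mul_left (M : ℂ)).congr' ?_ EventuallyEq.rfl
  filter_upwards with t
  rw [classTheta_eq_of_pos N M u v c t]
  ring

/-- Decay of `θ` at `0⁺`: `θ(t) = O(t^{-b})` for every `b`. [folklore] -/
theorem isBigO_nhdsGT_theta (b : ℝ) : theta N M u v Ψ =O[𝓝[>] 0] fun t : ℝ ↦ t ^ (-b) := by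
  unfold theta
  exact IsBigO.sum fun c _ ↦ (isBigO_nhdsGT_classTheta N M u v c b).const_mul_left _

omit [NeZero M] in
/-- `oddKernel a (L t) = O(t^{-A})` at `∞` for every `A` (`L > 0`; indeed exponential).
[folklore] -/
lemma isBigO_atTop_oddKernel_comp (a : UnitAddCircle) {L : ℝ} (hL : 0 < L) (A : ℝ) :
    (fun t : ℝ ↦ (oddKernel a (L * t) : ℂ)) =O[atTop] fun t : ℝ ↦ t ^ (-A) := by
  have hten : Tendsto (fun t : ℝ ↦ L * t) atTop atTop := Tendsto.const_mul_atTop hL tendsto_id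
  obtain ⟨p, hp, h⟩ := isBigO_atTop_oddKernel a
  rw [Complex.isBigO_ofReal_left]
  refine (h.comp_tendsto hten).trans ?_
  have h' := (isLittleO_exp_neg_mul_rpow_atTop (mul_pos hp hL) (-A)).isBigO
  refine (IsBigO.of_bound 1 ?_).trans h'
  filter_upwards with t
  simp only [Function.comp_apply, one_mul, Real.norm_eq_abs, abs_of_pos (Real.exp_pos _)]
  exact le_of_eq (by ring_nf)

omit [NeZero M] in
/-- `evenKernel a (L t) = O(1)` at `∞` (`L > 0`). [folklore] -/
lemma isBigO_atTop_evenKernel_comp (a : UnitAddCircle) {L : ℝ} (hL : 0 < L) :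
    (fun t : ℝ ↦ (evenKernel a (L * t) : ℂ)) =O[atTop] fun _ : ℝ ↦ (1 : ℝ) := by
  have hten : Tendsto (fun t : ℝ ↦ L * t) atTop atTop := Tendsto.const_mul_atTop hL tendsto_id
  obtain ⟨p, hp, h⟩ := isBigO_atTop_evenKernel_sub a
  rw [Complex.isBigO_ofReal_left]
  have h1 : (fun x ↦ evenKernel a x - if a = 0 then 1 else 0) =O[atTop] fun _ ↦ (1 : ℝ) := by
    refine h.trans (IsBigO.of_bound 1 ?_)
    filter_upwards [eventually_ge_atTop 0] with w hw
    rw [Real.norm_eq_abs, abs_of_pos (Real.exp_pos _), norm_one, one_mul, Real.exp_le_one_iff]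
    nlinarith
  have h2 : (fun x ↦ evenKernel a x) =O[atTop] fun _ ↦ (1 : ℝ) := by
    simpa using h1.add (isBigO_const_const (if a = 0 then (1 : ℝ) else 0) one_ne_zero atTop)
  exact h2.comp_tendsto hten

/-- Decay of `Θ_c` at `∞`: `Θ_c(t) = O(t^{-A})` for every `A`. [folklore] -/
theorem isBigO_atTop_classTheta (c : ZMod M × ZMod M) (A : ℝ) :
    classTheta N M u v c =O[atTop] fun t : ℝ ↦ t ^ (-A) := by
  have hM : (0 : ℝ) < M := by exact_mod_cast Nat.pos_of_ne_zero (NeZero.ne M)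
  have hN : (0 : ℝ) < N := by exact_mod_cast Nat.pos_of_ne_zero (NeZero.ne N)
  have hNM : (0 : ℝ) < N * M := mul_pos hN hM
  have hP₁ (a a' : UnitAddCircle) : (fun t : ℝ ↦ (oddKernel a (M * t) : ℂ) *
      (evenKernel a' (N * (M * t)) : ℂ)) =O[atTop] fun t : ℝ ↦ t ^ (-A) := by
    have h2 : (fun t : ℝ ↦ (evenKernel a' (N * (M * t)) : ℂ)) =O[atTop] fun _ : ℝ ↦ (1 : ℝ) := by
      refine (isBigO_atTop_evenKernel_comp a' hNM).congr_left fun t ↦ ?_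
      rw [mul_assoc]
    simpa using (isBigO_atTop_oddKernel_comp a hM A).mul h2
  have hP₂ (a a' : UnitAddCircle) : (fun t : ℝ ↦ (evenKernel a (M * t) : ℂ) *
      (oddKernel a' (N * (M * t)) : ℂ)) =O[atTop] fun t : ℝ ↦ t ^ (-A) := by
    have h2 : (fun t : ℝ ↦ (oddKernel a' (N * (M * t)) : ℂ)) =O[atTop] fun t : ℝ ↦ t ^ (-A) := by
      refine (isBigO_atTop_oddKernel_comp a' hNM A).congr_left fun t ↦ ?_
      rw [mul_assoc]
    simpa using (isBigO_atTop_evenKernel_comp a hM).mul h2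
  have key := (((hP₁ (((c.1.val : ℝ) / M : ℝ) : UnitAddCircle)
    (((c.2.val : ℝ) / M : ℝ) : UnitAddCircle)).const_mul_left u).add
    ((hP₂ (((c.1.val : ℝ) / M : ℝ) : UnitAddCircle)
    (((c.2.val : ℝ) / M : ℝ) : UnitAddCircle)).const_mul_left v)).const_mul_left (M : ℂ)
  unfold classTheta
  exact key

/-- Decay of `θ` at `∞`: `θ(t) = O(t^{-A})` for every `A`. [folklore] -/
theorem isBigO_atTop_theta (A : ℝ) : theta N M u v Ψ =O[atTop] fun t : ℝ ↦ t ^ (-A) := by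
  unfold theta
  exact IsBigO.sum fun c _ ↦ (isBigO_atTop_classTheta N M u v c A).const_mul_left _

/-- `Θ_c` is continuous on `(0, ∞)`. [folklore] -/
theorem continuousOn_classTheta (c : ZMod M × ZMod M) :
    ContinuousOn (classTheta N M u v c) (Ioi 0) := by
  have hM : (0 : ℝ) < M := by exact_mod_cast Nat.pos_of_ne_zero (NeZero.ne M)
  have hN : (0 : ℝ) < N := by exact_mod_cast Nat.pos_of_ne_zero (NeZero.ne N)
  have hmaps : MapsTo (fun t : ℝ ↦ (M : ℝ) * t) (Ioi 0) (Ioi 0) := fun t ht ↦ mul_pos hM ht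
  have hmaps' : MapsTo (fun t : ℝ ↦ (N : ℝ) * ((M : ℝ) * t)) (Ioi 0) (Ioi 0) := fun t ht ↦
    mul_pos hN (mul_pos hM ht)
  have hlin : ContinuousOn (fun t : ℝ ↦ (M : ℝ) * t) (Ioi 0) :=
    (continuous_const.mul continuous_id).continuousOn
  have hlin' : ContinuousOn (fun t : ℝ ↦ (N : ℝ) * ((M : ℝ) * t)) (Ioi 0) :=
    (continuous_const.mul (continuous_const.mul continuous_id)).continuousOn
  have hO (a : UnitAddCircle) : ContinuousOn (fun t : ℝ ↦ (oddKernel a (M * t) : ℂ)) (Ioi 0) :=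
    continuous_ofReal.comp_continuousOn ((continuousOn_oddKernel a).comp hlin hmaps)
  have hE (a : UnitAddCircle) : ContinuousOn (fun t : ℝ ↦ (evenKernel a (M * t) : ℂ)) (Ioi 0) :=
    continuous_ofReal.comp_continuousOn ((continuousOn_evenKernel a).comp hlin hmaps)
  have hO' (a : UnitAddCircle) :
      ContinuousOn (fun t : ℝ ↦ (oddKernel a (N * (M * t)) : ℂ)) (Ioi 0) :=
    continuous_ofReal.comp_continuousOn ((continuousOn_oddKernel a).comp hlin' hmaps')
  have hE' (a : UnitAddCircle) :
      ContinuousOn (fun t : ℝ ↦ (evenKernel a (N * (M * t)) : ℂ)) (Ioi 0) :=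
    continuous_ofReal.comp_continuousOn ((continuousOn_evenKernel a).comp hlin' hmaps')
  have key : ContinuousOn (fun t : ℝ ↦ (M : ℂ) *
      (u * ((oddKernel (((c.1.val : ℝ) / M : ℝ) : UnitAddCircle) (M * t) : ℂ) *
          (evenKernel (((c.2.val : ℝ) / M : ℝ) : UnitAddCircle) (N * (M * t)) : ℂ)) +
        v * ((evenKernel (((c.1.val : ℝ) / M : ℝ) : UnitAddCircle) (M * t) : ℂ) *
          (oddKernel (((c.2.val : ℝ) / M : ℝ) : UnitAddCircle) (N * (M * t)) : ℂ)))) (Ioi 0) :=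
    continuousOn_const.mul ((continuousOn_const.mul ((hO _).mul (hE' _))).add
      (continuousOn_const.mul ((hE _).mul (hO' _))))
  unfold classTheta
  exact key

/-- `θ` is continuous on `(0, ∞)`. [folklore] -/
theorem continuousOn_theta : ContinuousOn (theta N M u v Ψ) (Ioi 0) := by
  unfold theta
  exact continuousOn_finsetSum _ fun c _ ↦
    continuousOn_const.mul (continuousOn_classTheta N M u v c)

/-- **The Mellin transform of `θ` is entire** (decay `O(t^{-A})` at `∞` and `O(t^{-b})` at `0⁺`
for all `A`, `b`). [folklore] -/
theorem differentiable_mellin_theta : Differentiable ℂ (mellin (theta N M u v Ψ)) := fun s ↦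
  mellin_differentiableAt_of_isBigO_rpow (a := s.re + 1) (b := s.re - 1)
    ((continuousOn_theta N M u v Ψ).locallyIntegrableOn measurableSet_Ioi)
    (isBigO_atTop_theta N M u v Ψ _) (by linarith) (isBigO_nhdsGT_theta N M u v Ψ _) (by linarith)

/-! ### The entire continuation of `∑ c(m) m^{-s}` -/

/-- The entire function `(π/M)^s Γ(s)^{-1} ∫₀^∞ θ(t) t^{s-1} dt`, which for `Re s > 3/2` is the
`L`-series `∑_y Ψ(y) w(y) Q_N(y)^{-s} = ∑_m c(m) m^{-s}` (`thetaLFunction_eq_LSeries`;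
Hecke 1920 §9). [folklore] -/
def thetaLFunction (s : ℂ) : ℂ :=
  (π : ℂ) ^ s * (M : ℂ) ^ (-s) * (Complex.Gamma s)⁻¹ * mellin (theta N M u v Ψ) s

/-- **`thetaLFunction` is entire** (`1/Γ` and the Mellin transform of `θ` are entire).
[folklore] -/
theorem differentiable_thetaLFunction : Differentiable ℂ (thetaLFunction N M u v Ψ) := by
  have hπ : (π : ℂ) ≠ 0 := ofReal_ne_zero.mpr Real.pi_ne_zero
  have hM : (M : ℂ) ≠ 0 := Nat.cast_ne_zero.mpr (NeZero.ne M)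
  have h1 : Differentiable ℂ fun s : ℂ ↦ (π : ℂ) ^ s := fun s ↦
    differentiableAt_id.const_cpow (Or.inl hπ)
  have h2 : Differentiable ℂ fun s : ℂ ↦ (M : ℂ) ^ (-s) := fun s ↦
    differentiableAt_id.neg.const_cpow (Or.inl hM)
  unfold thetaLFunction
  exact ((h1.mul h2).mul Complex.differentiable_one_div_Gamma).mul
    (differentiable_mellin_theta N M u v Ψ)

/-- For `Re s > 3/2`, `thetaLFunction N M u v Ψ s = ∑_y Ψ(y) w(y) Q_N(y)^{-s}` (absolutely
convergent). [folklore] -/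
theorem hasSum_thetaLFunction (hΨ : ∀ y z : ℤ × ℤ, Ψ (y.1 + M * z.1, y.2 + M * z.2) = Ψ y)
    {s : ℂ} (hs : 3 / 2 < s.re) :
    HasSum (fun y : ℤ × ℤ ↦ Ψ y * wt u v y / (((qf N y : ℤ) : ℂ)) ^ s)
      (thetaLFunction N M u v Ψ s) := by
  have hM : (0 : ℝ) < M := by exact_mod_cast Nat.pos_of_ne_zero (NeZero.ne M)
  have hπ : (π : ℂ) ≠ 0 := ofReal_ne_zero.mpr Real.pi_ne_zero
  have hMc : (M : ℂ) ≠ 0 := Nat.cast_ne_zero.mpr (NeZero.ne M)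
  have h := hasSum_mellin_theta N M u v Ψ hΨ hs
  set C : ℂ := (π : ℂ) ^ (-s) * Complex.Gamma s * (M : ℂ) ^ s with hC
  have hC0 : C ≠ 0 := mul_ne_zero (mul_ne_zero (Complex.cpow_ne_zero_iff.mpr (Or.inl hπ))
    (Complex.Gamma_ne_zero_of_re_pos (by linarith))) (Complex.cpow_ne_zero_iff.mpr (Or.inl hMc))
  have h2 : HasSum (fun y : ℤ × ℤ ↦ C * (Ψ y * wt u v y / (((qf N y : ℤ) : ℂ)) ^ s))
      (mellin (theta N M u v Ψ) s) := by
    refine h.congr_fun fun y ↦ ?_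
    rcases eq_or_ne y 0 with rfl | hy
    · simp
    · rw [GaussianTheta.ofReal_div_cpow (by exact_mod_cast qf_nonneg N y) hM, div_div_eq_mul_div,
        hC]
      push_cast
      ring
  have h3 := h2.mul_left C⁻¹
  have h4 : C⁻¹ * mellin (theta N M u v Ψ) s = thetaLFunction N M u v Ψ s := by
    simp only [thetaLFunction, hC, mul_inv, Complex.cpow_neg, inv_inv]
    ring
  rw [h4] at h3
  refine h3.congr_fun fun y ↦ ?_
  rw [inv_mul_cancel_left₀ hC0]

/-- **The `L`-series of `θ` and its entire continuation.** For `Ψ : ℤ × ℤ → ℂ` periodic modulo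
`M` and `Re s > 3/2`, `∑_m c(m) m^{-s}` converges (absolutely) to `thetaLFunction N M u v Ψ s`.
[folklore] -/
theorem LSeriesHasSum_coeff (hΨ : ∀ y z : ℤ × ℤ, Ψ (y.1 + M * z.1, y.2 + M * z.2) = Ψ y)
    {s : ℂ} (hs : 3 / 2 < s.re) :
    LSeriesHasSum (coeff N u v Ψ) s (thetaLFunction N M u v Ψ s) :=
  LSeriesHasSum_coeff_of_hasSum N u v Ψ (hasSum_thetaLFunction N M u v Ψ hΨ hs)

/-- For `Re s > 3/2` the `L`-series `∑ c(m) m^{-s}` converges absolutely. [folklore] -/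
theorem LSeriesSummable_coeff (hΨ : ∀ y z : ℤ × ℤ, Ψ (y.1 + M * z.1, y.2 + M * z.2) = Ψ y)
    {s : ℂ} (hs : 3 / 2 < s.re) : LSeriesSummable (coeff N u v Ψ) s :=
  (LSeriesHasSum_coeff N M u v Ψ hΨ hs).LSeriesSummable

/-- For `Re s > 3/2`, `thetaLFunction N M u v Ψ s = ∑ c(m) m^{-s}` (Hecke 1920 §9). [folklore] -/
theorem thetaLFunction_eq_LSeries (hΨ : ∀ y z : ℤ × ℤ, Ψ (y.1 + M * z.1, y.2 + M * z.2) = Ψ y)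
    {s : ℂ} (hs : 3 / 2 < s.re) : thetaLFunction N M u v Ψ s = LSeries (coeff N u v Ψ) s :=
  ((LSeriesHasSum_coeff N M u v Ψ hΨ hs).LSeries_eq).symm

/-- **Hecke: weight-one theta `L`-series of the binary forms `y₁² + N y₂²` are entire.** For every
`N, M ≥ 1`, all weights `u, v ∈ ℂ` and every `Ψ : ℤ × ℤ → ℂ` periodic modulo `M`, the Dirichlet
series `∑_{m ≥ 1} (∑_{y₁² + N y₂² = m} Ψ(y) (u y₁ + v y₂)) m^{-s}`, absolutely convergent for
`Re s > 3/2`, is the restriction of an entire function (Hecke, Math. Z. 6 (1920) §9, theta series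
with Grössencharakteren of imaginary quadratic fields; the argument printed for `ℚ(i)` in Koblitz,
*Introduction to Elliptic Curves and Modular Forms*, Ch. II §5, Theorem).
[cite: KoblitzECMF1993, Ch. II §5, Theorem (proof)] -/
theorem exists_differentiable_eq_LSeries_coeff
    (hΨ : ∀ y z : ℤ × ℤ, Ψ (y.1 + M * z.1, y.2 + M * z.2) = Ψ y) :
    ∃ G : ℂ → ℂ, Differentiable ℂ G ∧ ∀ s : ℂ, 3 / 2 < s.re → G s = LSeries (coeff N u v Ψ) s :=
  ⟨thetaLFunction N M u v Ψ, differentiable_thetaLFunction N M u v Ψ,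
    fun _ hs ↦ thetaLFunction_eq_LSeries N M u v Ψ hΨ hs⟩

end BinaryTheta

end Literature.NumberTheory.LFunctions
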